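import Mathlib
import Summits.CriticalPhenomena.Ising3DConformalLimit.Theses.HyperoctahedralRP
-- import Summits.CriticalPhenomena.Ising3DConformalLimit.Theorems.HRP2Rigidity.Negative.LoadBearing
--   ^ the landed Negative lemma file of this crux (hrp2Rigidity_false_without_RP, 2026-08-16T00:35Z); the farm
--     still reports the module `stale:unbuilt` at publication time — re-enable this one line once it is built.
import Literature.MathematicalPhysics.QuantumFieldTheory.LatticeMirrorNormals
import Literature.MathematicalPhysics.QuantumFieldTheory.MirrorRPKernel
import Literature.Analysis.SpecialFunctions.IsStieltjesFunction

/-!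
# Line `bounded-phase-quadric-liouville` — checked skeleton for crux `HyperoctahedralRP.HRP2Rigidity`

Crux (item stmt-CriticalPhenomena-1979, route HyperoctahedralRP, rank 2; decl
`Summit.CriticalPhenomena.Ising3DConformalLimit.Theses.HyperoctahedralRP.HRP2Rigidity`, FIXED):
a continuous positive kernel `K` on `ℝ³∖{0}`, homogeneous of degree `-2Δ`, `1/2 ≤ Δ ≤ 1`, invariant and
reflection positive for the nine `B₃` mirror normals `e_i, e_i ± e_j`, is `O(3)`-invariant.

IDEA (card `Ideas/bounded-phase-quadric-liouville.md`, triage r1: pass ×3). Write `a = 3/2 - Δ ∈ [1/2, 1]`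
and `K̂(k) = ‖k‖^(-2a) C(k)` with `C` the 0-homogeneous Fourier PROFILE. Reflection positivity in direction
`n` makes every pencil `s ↦ K̂(u + √s n̂)`, `u ⊥ n`, a STIELTJES function (BCR Thm 4.2.8 + homogeneity);
taking logarithms, the Stieltjes mapping property (`Im f ≤ 0` on the upper half-plane) is EXACTLY a phase
band of width `π` for `log C` along every leaf (great circle through a pole): `|Im log C| < π` off the wall
lines `Re ψ ∈ (π/2)ℤ` of the leaf parameter `ψ`. Endgame = Liouville for holomorphic functions with
bounded imaginary part (no growth / degree bookkeeping, uniform in `a`).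

SKELETON (7 registered stubs + the kernel-checked composition `HRP2Rigidity_of`):
* `stub_dictionary`      — S1 DICTIONARY + LOCAL step: the Fourier profile `C` exists, is real-analytic off
                             `0`, positive, 0-homogeneous, nine-mirror invariant, and all nine-fan pencils are
                             Stieltjes (`IsFourierProfile`). RP and the window `Δ ≤ 1 < 3/2` enter HERE.
* `stub_leafBand`        — S2 BAND LEMMA (the lever): every leaf function is holomorphic off the wall lines
                             with a holomorphic logarithm of `|Im| < π` (`NineLeafBand`); uses `Δ ≥ 1/2`.
* `stub_sevenCircles`    — S3 a-UNIFORM CIRCLE LEMMA: `C` is constant (= `C e₀`) on the 7 bipolar great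
                             circles `{k_i = 0}`, `{±k₁ ± k₂ ± k₃ = 0}` (`NetConstant`).
* `stub_monotoneEndpoint`— S4 the endpoint `Δ = 1/2` (`a = 1`): leaf monotonicity (Disproof F9) gives
                             `C ≡ C e₀` (`GlobalConstant`).
* `stub_noSpacelikeMass` — S5a OPEN CORE 1 (`1/2 < Δ ≤ 1`): no pencil carries spectral mass below the
                             light cone, `σ([0,1)) = 0` (`NoSpacelikeMass` = (L) of the Landau/Laplace lines).
* `stub_polarPhase`      — S5b OPEN CORE 2 (`1/2 < Δ ≤ 1`): given (L), the polar walls are removable: every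
                             leaf function is ENTIRE with a logarithm of `|Im| ≤ π` (`NineLeafEntire`;
                             Dyson/JLD mode count or Disproof F12's tangent space).
* `stub_fourierUniqueness` — S7 a constant profile forces `K ∘ R = K` (Fourier uniqueness against
                             Schwartz pairings).
Sorry-free, kernel-checked: `boundedPhaseLiouville` (entire + `|Im| ≤ π` ⇒ constant) and
`globalConstant_of_nineLeafEntire` (the Liouville ENDGAME: `NineLeafEntire C` ⇒ `C` constant), and the
composition `HRP2Rigidity_of : HRP2Rigidity` (case split `Δ = 1/2` / `Δ > 1/2`); sorries ONLY in `stub_*`.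

DISPROOF USED (`Cruxes/HRP2Rigidity/Disproof.lean`, gen-2 cycle 2; landed
`Theorems/HRP2Rigidity/Negative/LoadBearing.lean`, import line above, pending the farm build):
`hrp2Rigidity_false_without_RP` — honoured: RP is consumed in `stub_dictionary` (pencils Stieltjes; the quartic
witness `(Σxᵢ⁴)/‖x‖⁶` has non-Stieltjes diagonal pencils, refuter note 12:19Z Hankel tests); `footpoint_bound`
(all that `m ≤ 2` gives) — the line uses `m ≥ 3` through the spectral (Stieltjes) side; F2 (7-circle lemma) =
`stub_sevenCircles`; F9 (a = 1 monotonicity) = `stub_monotoneEndpoint`; F6/F11/F12 (spacelike vs timelike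
mass, tangent space at `a < 1`) = the S5a/S5b cut; `hrp2RigidityAt_of_add` (Δ-monotonicity) explains why the
open stubs are stated on `1/2 < Δ ≤ 1` with `Δ = 1` the hardest point. No stub is an instance of a landed
Negative lemma (the only landed one refutes the crux WITHOUT RP; every stub here carries `CruxHyp`, incl. RP).
-/

noncomputable section

open scoped BigOperators InnerProductSpace FourierTransform SchwartzMap
open MeasureTheory Set

namespace Summit.CriticalPhenomena.Ising3DConformalLimit.Cruxes.HRP2Rigidity.BoundedPhaseQuadricLiouville

open Literature.MathematicalPhysics.QuantumFieldTheory Literature.Analysis.SpecialFunctions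

/-! ## Vocabulary -/

/-- `ℝ³` as a Euclidean space. -/
abbrev E3 := EuclideanSpace ℝ (Fin 3)

/-- The nine-normal shape predicate, verbatim from the crux
(`= n ∈ latticeMirrorNormals (Fin 3)` by `Iff.rfl`). -/
def NineNormal (n : E3) : Prop :=
  ∃ i j : Fin 3, i ≠ j ∧ (n = EuclideanSpace.single i 1 ∨
    n = EuclideanSpace.single i 1 + EuclideanSpace.single j 1 ∨
    n = EuclideanSpace.single i 1 - EuclideanSpace.single j 1)

theorem nineNormal_iff_mem (n : E3) : NineNormal n ↔ n ∈ latticeMirrorNormals (Fin 3) := Iff.rfl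

/-- The unit vector `n̂ = n / ‖n‖` along a normal. -/
def unitOf (n : E3) : E3 := ‖n‖⁻¹ • n

/-- The reference direction `e₀`. -/
def e0 : E3 := EuclideanSpace.single 0 1

/-- The hypotheses of the crux on `(Δ, K)`, bundled verbatim (the last conjunct of `nine` is
`IsMirrorRPKernel n K` by `Iff.rfl`). -/
structure CruxHyp (Δ : ℝ) (K : E3 → ℝ) : Prop where
  half_le : 1/2 ≤ Δ
  le_one : Δ ≤ 1
  continuousOn : ContinuousOn K {0}ᶜ
  pos : ∀ x, x ≠ 0 → 0 < K x
  homogeneous : ∀ c : ℝ, 0 < c → ∀ x, K (c • x) = c ^ (-(2 * Δ)) * K x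
  nine : ∀ n : E3, NineNormal n →
    (∀ x, K (((ℝ ∙ n)ᗮ).reflection x) = K x) ∧
    (∀ (m : ℕ) (p : Fin m → E3) (c : Fin m → ℝ), (∀ a, 0 < inner ℝ (p a) n) →
      0 ≤ ∑ a, ∑ b, c a * c b * K (p a - ((ℝ ∙ n)ᗮ).reflection (p b)))

theorem CruxHyp.isMirrorRPKernel {Δ : ℝ} {K : E3 → ℝ} (h : CruxHyp Δ K) {n : E3} (hn : NineNormal n) :
    IsMirrorRPKernel n K := (h.nine n hn).2

/-- The PENCIL FUNCTION of a profile `C` for the pole `n` through the unit vector `u ⊥ n`: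
`s ↦ ‖u + √s n̂‖^(-2a) C (u + √s n̂) = (1 + s)^(-(3/2 - Δ)) C (u + √s n̂)`, i.e. `K̂` restricted to the
pencil `u + √s n̂` when `K̂ = ‖k‖^(-(3 - 2Δ)) C`. Only `s > 0` matters. -/
def pencil (Δ : ℝ) (C : E3 → ℝ) (n u : E3) (s : ℝ) : ℝ :=
  (1 + s) ^ (-(3 / 2 - Δ)) * C (u + Real.sqrt s • unitOf n)

/-- **The Fourier profile dictionary + LOCAL step** (output of S1). `C : ℝ³ → ℝ` is the 0-homogeneous
angular profile of the distributional Fourier transform of `K`: `K̂ = ‖k‖^(-(3 - 2Δ)) · C` in the sense of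
Schwartz pairings (Mathlib's `𝓕` convention; constants are absorbed into `C`), `C` is REAL-ANALYTIC (hence
continuous) and positive off `0`, even and 0-homogeneous (`C (c • k) = C k`, `c ≠ 0`), invariant under the
nine lattice mirrors, and for every nine-normal `n` and unit `u ⊥ n` the pencil function is a Stieltjes
function (`Literature.Analysis.SpecialFunctions.IsStieltjesFunction`: `a/s + b + ∫ dσ(t)/(s+t)`).
Real-analyticity off `0` (= on `S²`, by 0-homogeneity) is the route's LOCAL step: continuity of the spectral
density + separate Stieltjes-analyticity along the leaves of ≥ 2 transverse fans at every point (a plane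
holds ≤ 4 of the nine normals; gnomonic chart with both poles on the horizon makes the two fans parallel line
families) + the Bernstein–Siciak cross theorem. -/
structure IsFourierProfile (Δ : ℝ) (K : E3 → ℝ) (C : E3 → ℝ) : Prop where
  analytic : AnalyticOnNhd ℝ C {0}ᶜ
  pos : ∀ k, k ≠ 0 → 0 < C k
  homogeneous : ∀ c : ℝ, c ≠ 0 → ∀ k, C (c • k) = C k
  nine_inv : ∀ n : E3, NineNormal n → ∀ k, C (((ℝ ∙ n)ᗮ).reflection k) = C k
  fourier : ∀ φ : 𝓢(E3, ℂ),
    ∫ x, (K x : ℂ) * 𝓕 (φ : E3 → ℂ) x = ∫ k, ((‖k‖ ^ (-(3 - 2 * Δ)) * C k : ℝ) : ℂ) * φ k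
  stieltjes : ∀ n : E3, NineNormal n → ∀ u : E3, ⟪u, n⟫_ℝ = 0 → ‖u‖ = 1 →
    IsStieltjesFunction (pencil Δ C n u)

/-- The complement of the WALL LINES `Re ψ ∈ (π/2)ℤ` in the plane of the complexified leaf parameter `ψ`
(equatorial walls `Re ψ ∈ πℤ` = spacelike spectral mass, polar walls `Re ψ ∈ π/2 + πℤ` = timelike mass). -/
def offWalls : Set ℂ := {ψ | ∀ m : ℤ, ψ.re ≠ (m : ℝ) * (Real.pi / 2)}

/-- The LEAF (great circle) of pole `n` through `u`: `ψ ↦ cos ψ · u + sin ψ · n̂` (`ψ = 0` at the equator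
point `u`, `ψ = π/2` at the pole). -/
def leafPoint (n u : E3) (ψ : ℝ) : E3 := Real.cos ψ • u + Real.sin ψ • unitOf n

/-- **Bounded-phase leaf continuation** (output of S2 for one leaf): the leaf function
`ψ ↦ C (leafPoint n u ψ)` is the restriction to `ℝ` of a function `G` holomorphic off the wall lines which
has there a holomorphic logarithm `H` with `|Im H| < π` (the phase band of width `π` = the Stieltjes mapping
property of the pencils, transported by `s = tan² ψ`). -/
def LeafBand (C : E3 → ℝ) (n u : E3) : Prop :=
  ∃ G H : ℂ → ℂ, DifferentiableOn ℂ G offWalls ∧ DifferentiableOn ℂ H offWalls ∧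
    (∀ ψ ∈ offWalls, Complex.exp (H ψ) = G ψ ∧ |(H ψ).im| < Real.pi) ∧
    (∀ ψ : ℝ, G ψ = (C (leafPoint n u ψ) : ℂ))

/-- Bounded-phase continuation along every leaf of every one of the nine fans. -/
def NineLeafBand (C : E3 → ℝ) : Prop :=
  ∀ n : E3, NineNormal n → ∀ u : E3, ⟪u, n⟫_ℝ = 0 → ‖u‖ = 1 → LeafBand C n u

/-- The 7-CIRCLE NET: the three coordinate great circles `{k_i = 0}` and the four hexagonal ones
`{±k₀ ± k₁ ± k₂ = 0}` — the great circles through two poles that are neither parallel nor perpendicular. -/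
def OnSevenCircles (k : E3) : Prop :=
  k 0 = 0 ∨ k 1 = 0 ∨ k 2 = 0 ∨ k 0 + k 1 + k 2 = 0 ∨ k 0 + k 1 = k 2 ∨ k 0 + k 2 = k 1 ∨ k 1 + k 2 = k 0

/-- `C` is constant (equal to `C e₀`) on the 7-circle net (output of S3). -/
def NetConstant (C : E3 → ℝ) : Prop := ∀ k : E3, k ≠ 0 → OnSevenCircles k → C k = C e0

/-- `C` is constant off the origin (output of S4, and of S5b via `globalConstant_of_nineLeafEntire`; the
GLOBAL step). -/
def GlobalConstant (C : E3 → ℝ) : Prop := ∀ k : E3, k ≠ 0 → C k = C e0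

/-- **Walls removed on one leaf** (output of S5b for one leaf): the leaf function is the restriction of an
ENTIRE `G` with an entire logarithm `H` of `|Im| ≤ π` — the leafwise form of the card's transfer `C⁺`
(bounded phase along the complexified great circle through a pole). -/
def LeafEntire (C : E3 → ℝ) (n u : E3) : Prop :=
  ∃ G H : ℂ → ℂ, Differentiable ℂ G ∧ Differentiable ℂ H ∧
    (∀ ψ : ℂ, Complex.exp (H ψ) = G ψ ∧ |(H ψ).im| ≤ Real.pi) ∧
    (∀ ψ : ℝ, G ψ = (C (leafPoint n u ψ) : ℂ))

/-- Walls removed on every leaf of every one of the nine fans. -/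
def NineLeafEntire (C : E3 → ℝ) : Prop :=
  ∀ n : E3, NineNormal n → ∀ u : E3, ⟪u, n⟫_ℝ = 0 → ‖u‖ = 1 → LeafEntire C n u

/-- **(L) — no spacelike Källén–Lehmann mass in any of the nine fans** (output of S5a): every pencil
function is `∫ dσ(t)/(s+t)` with `σ` carried by `[1, ∞)` (`t = 1` ↔ the light cone `λ = |ξ|`; `t < 1` ↔
spacelike mass ↔ a jump of `Im log C` across an equatorial wall). Equivalent, fibrewise, to forward-light-cone
support of the nine Laplace (Osterwalder–Schrader) measures of `K` — the target (L) of the Landau-pinning /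
Laplace-light-cone lines of this crux. -/
def NoSpacelikeMass (Δ : ℝ) (C : E3 → ℝ) : Prop :=
  ∀ n : E3, NineNormal n → ∀ u : E3, ⟪u, n⟫_ℝ = 0 → ‖u‖ = 1 →
    ∃ σ : Measure ℝ, σ (Iio 1) = 0 ∧ Integrable (fun t : ℝ => (1 + t)⁻¹) σ ∧
      ∀ s : ℝ, 0 < s → pencil Δ C n u s = ∫ t, (s + t)⁻¹ ∂σ

/-! ## The Liouville endgame (sorry-free; the `a`-uniform tool behind S3 and S5b) -/

/-- **Bounded-phase Liouville.** An entire function whose imaginary part is bounded by `π` is constant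
(Liouville applied to `exp (-I g)`). This is what turns "the leaf logarithm is entire with phase in the
band" into "the leaf profile is constant"; re-proved here (triage r1-1, W.lean) so that S3/S5b provers can
cite it. -/
theorem boundedPhaseLiouville (g : ℂ → ℂ) (hg : Differentiable ℂ g)
    (hb : ∀ z : ℂ, |(g z).im| ≤ Real.pi) : ∀ z w : ℂ, g z = g w := by
  have hF : Differentiable ℂ (fun z => Complex.exp (-Complex.I * g z)) := by fun_prop
  have hbdd : Bornology.IsBounded (Set.range fun z => Complex.exp (-Complex.I * g z)) := by
    rw [isBounded_iff_forall_norm_le]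
    refine ⟨Real.exp Real.pi, ?_⟩
    rintro _ ⟨z, rfl⟩
    rw [Complex.norm_exp]
    apply Real.exp_le_exp.mpr
    have : (-Complex.I * g z).re = (g z).im := by simp
    rw [this]
    exact (le_abs_self _).trans (hb z)
  have hconst := hF.apply_eq_apply_of_bounded hbdd
  have hderiv : ∀ z, deriv g z = 0 := by
    intro z
    have h1 : HasDerivAt (fun z => Complex.exp (-Complex.I * g z))
        (Complex.exp (-Complex.I * g z) * (-Complex.I * deriv g z)) z :=
      ((hg z).hasDerivAt.const_mul (-Complex.I)).cexp
    have h2 : HasDerivAt (fun z => Complex.exp (-Complex.I * g z)) 0 z := by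
      have : (fun z => Complex.exp (-Complex.I * g z)) = fun _ => Complex.exp (-Complex.I * g 0) :=
        funext fun z => hconst z 0
      rw [this]; exact hasDerivAt_const _ _
    have h3 := h1.unique h2
    rcases mul_eq_zero.mp h3 with h | h
    · exact absurd h (Complex.exp_ne_zero _)
    · simpa [Complex.I_ne_zero] using h
  exact fun z w => is_const_of_deriv_eq_zero hg hderiv z w

theorem nineNormal_e0 : NineNormal e0 := ⟨0, 1, by decide, Or.inl rfl⟩

theorem norm_e0 : ‖e0‖ = 1 := by
  simp [e0]

theorem unitOf_e0 : unitOf e0 = e0 := by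
  simp [unitOf, norm_e0]

/-- **The Liouville endgame, kernel-checked.** If every leaf of every fan carries an ENTIRE continuation
with bounded phase (`NineLeafEntire`, the output of S5b) and `C` is 0-homogeneous, then `C` is constant off
the origin: every `k ≠ 0` lies (up to a positive scalar) on a leaf of the fan `e₀`, whose logarithm is a
constant by `boundedPhaseLiouville`, so `C k = C (leaf at ψ = π/2) = C e₀`. -/
theorem globalConstant_of_nineLeafEntire (C : E3 → ℝ)
    (hhom : ∀ c : ℝ, c ≠ 0 → ∀ k : E3, C (c • k) = C k) (hent : NineLeafEntire C) :
    GlobalConstant C := by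
  intro k hk
  have hknorm : ‖k‖ ≠ 0 := norm_ne_zero_iff.2 hk
  -- normalise `k` and split it along `e₀` (opaque local names, equations kept as hypotheses)
  obtain ⟨kh, hkh⟩ : ∃ kh : E3, kh = ‖k‖⁻¹ • k := ⟨_, rfl⟩
  have hCk : C kh = C k := by rw [hkh]; exact hhom _ (inv_ne_zero hknorm) k
  have hkh0 : kh ≠ 0 := by rw [hkh]; exact smul_ne_zero (inv_ne_zero hknorm) hk
  obtain ⟨t, ht⟩ : ∃ t : ℝ, t = ⟪kh, e0⟫_ℝ := ⟨_, rfl⟩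
  obtain ⟨v, hv⟩ : ∃ v : E3, v = kh - t • e0 := ⟨_, rfl⟩
  have he0e0 : ⟪e0, e0⟫_ℝ = 1 := by
    rw [real_inner_self_eq_norm_sq, norm_e0]; norm_num
  have hve0 : ⟪v, e0⟫_ℝ = 0 := by
    rw [hv, inner_sub_left, real_inner_smul_left, he0e0, ← ht]; ring
  have hkv : kh = v + t • e0 := by rw [hv, sub_add_cancel]
  by_cases hv0 : v = 0
  · -- `k` is a multiple of `e₀`
    have hkt : kh = t • e0 := by rw [hkv, hv0, zero_add]
    have ht0 : t ≠ 0 := by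
      intro h0
      apply hkh0
      rw [hkt, h0, zero_smul]
    rw [← hCk, hkt, hhom t ht0]
  · -- `k` lies on the leaf of the fan `e₀` through `u = v/‖v‖`
    have hvnorm : ‖v‖ ≠ 0 := norm_ne_zero_iff.2 hv0
    obtain ⟨u, hu⟩ : ∃ u : E3, u = ‖v‖⁻¹ • v := ⟨_, rfl⟩
    have hu1 : ‖u‖ = 1 := by
      rw [hu, norm_smul, norm_inv, norm_norm, inv_mul_cancel₀ hvnorm]
    have hue0 : ⟪u, e0⟫_ℝ = 0 := by
      rw [hu, real_inner_smul_left, hve0, mul_zero]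
    have hvu : ‖v‖ • u = v := by
      rw [hu, smul_smul, mul_inv_cancel₀ hvnorm, one_smul]
    have hkh' : kh = ‖v‖ • u + t • e0 := by rw [hvu]; exact hkv
    obtain ⟨G, H, _hG, hH, hexp, hreal⟩ := hent e0 nineNormal_e0 u hue0 hu1
    have hHconst := boundedPhaseLiouville H hH (fun z => (hexp z).2)
    have hGconst : ∀ z w : ℂ, G z = G w := fun z w => by
      rw [← (hexp z).1, ← (hexp w).1, hHconst z w]
    -- the angle `ψ₀ = arg z` with `(cos ψ₀, sin ψ₀) ∝ (‖v‖, t)`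
    obtain ⟨z, hz⟩ : ∃ z : ℂ, z = (‖v‖ : ℂ) + (t : ℂ) * Complex.I := ⟨_, rfl⟩
    have hzre : z.re = ‖v‖ := by rw [hz]; simp
    have hzim : z.im = t := by rw [hz]; simp
    have hz0 : z ≠ 0 := by
      intro h
      have h' : z.re = 0 := by rw [h]; simp
      rw [hzre] at h'
      exact hvnorm h'
    have hznorm : ‖z‖ ≠ 0 := norm_ne_zero_iff.2 hz0
    have hcos : Real.cos (Complex.arg z) = ‖v‖ / ‖z‖ := by rw [Complex.cos_arg hz0, hzre]
    have hsin : Real.sin (Complex.arg z) = t / ‖z‖ := by rw [Complex.sin_arg, hzim]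
    have hleaf : leafPoint e0 u (Complex.arg z) = ‖z‖⁻¹ • kh := by
      rw [leafPoint, unitOf_e0, hcos, hsin, hkh', smul_add, smul_smul, smul_smul, div_eq_inv_mul,
        div_eq_inv_mul]
    have hpole : leafPoint e0 u (Real.pi / 2) = e0 := by
      rw [leafPoint, unitOf_e0, Real.cos_pi_div_two, Real.sin_pi_div_two, zero_smul, one_smul, zero_add]
    have key : (C (leafPoint e0 u (Complex.arg z)) : ℂ) = (C (leafPoint e0 u (Real.pi / 2)) : ℂ) := by
      rw [← hreal (Complex.arg z), ← hreal (Real.pi / 2)]; exact hGconst _ _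
    rw [hpole, hleaf, hhom _ (inv_ne_zero hznorm), hCk] at key
    exact_mod_cast key

/-! ## The registered stubs -/

/-- **S1 · stub_dictionary — Fourier profile dictionary + LOCAL step.** Under the crux hypotheses the
distributional Fourier transform of `K` (locally integrable, tempered: `2Δ ≤ 2 < 3`) is
`‖k‖^(-(3-2Δ)) C(k)` with a REAL-ANALYTIC positive 0-homogeneous nine-mirror-invariant profile `C`, and
every nine-fan pencil `s ↦ K̂(u + √s n̂)` is a Stieltjes function. Why plausible: RP in direction `n` +
continuity + boundedness of `K` on `{⟨x,n⟩ ≥ t₀}` give the Laplace–Fourier representation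
`K(t n̂ + y) = ∫ e^{-λ|t|} e^{iξ·y} dν_n(λ,ξ)`, `ν_n ≥ 0` (BergChristensenRessel1984 Thm 4.2.8, §4.4); Fourier
transform in `(t,y)` gives `K̂(κ n̂ + q) = ∫ 2λ/(λ²+κ²) ν_n(dλ, q)`, a Stieltjes function of `s = κ²`
fibrewise, and `K̂ ≥ 0` is a positive homogeneous measure `r^{2Δ-1}dr ⊗ σ(dω)`; `a = 3/2 - Δ > 0` (the
WINDOW `Δ ≤ 1`) makes the fibre measures `(1+t)⁻¹`-integrable; positivity of `C` follows from `K > 0`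
(a zero of a Stieltjes pencil at an interior point kills the whole leaf, then the net, then everything).
What is NOT automatic and is the honest content (Disproof F9 residual loophole; triage r1-3 "regularity stub
first"): that `σ` has a CONTINUOUS density — the separate-Stieltjes-structure bootstrap in ≥ 3 spanning
directions (`span_latticeMirrorNormals_inner_ne_zero`) — after which joint REAL-ANALYTICITY on `S²` is the
cross theorem (Bernstein–Siciak; two transverse fans with locally uniform strip half-width at every point,
JarnickiPflug2011), the route's LOCAL step, delivered here once for all later stubs. RP is load-bearing exactly
here (`hrp2Rigidity_false_without_RP`: the quartic witness has non-Stieltjes diagonal pencils). Size: L. -/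
theorem stub_dictionary :
    ∀ (Δ : ℝ) (K : E3 → ℝ), CruxHyp Δ K → ∃ C : E3 → ℝ, IsFourierProfile Δ K C := by
  sorry

/-- Nine-normals are nonzero (bridge for the definition-free stubs). -/
theorem nineNormal_ne_zero {n : E3} (hn : NineNormal n) : n ≠ 0 :=
  ne_zero_of_mem_latticeMirrorNormals ((nineNormal_iff_mem n).1 hn)

/-- At `Δ = 1/2` the pencil is `(1 + s)⁻¹ C (u + √s n̂)` (bridge for S4). -/
theorem pencil_half_apply (C : E3 → ℝ) (n u : E3) (s : ℝ) :
    pencil (1 / 2) C n u s = (1 + s)⁻¹ * C (u + Real.sqrt s • ‖n‖⁻¹ • n) := by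
  simp only [pencil, unitOf]
  norm_num [Real.rpow_neg_one]

/-- **S2 · stub_leafBand — the band lemma (the lever of the line), ONE LEAF, definition-free.** For a profile
`C : ℝ³ → ℝ` positive off `0`, 0-homogeneous (`C (c • k) = C k`, `c ≠ 0`, so in particular even) and invariant
under the mirror `θ_n` of a normal `n ≠ 0`, and a unit `u ⊥ n` whose pencil
`s ↦ (1+s)^(-(3/2-Δ)) C (u + √s n̂)` is a Stieltjes function, with `1/2 ≤ Δ ≤ 3/2` (i.e. `0 ≤ a := 3/2 - Δ ≤ 1`):
the leaf function `ψ ↦ C (cos ψ u + sin ψ n̂)` is the restriction to `ℝ` of a `G` holomorphic off the wall lines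
`Re ψ ∈ (π/2)ℤ` having there a holomorphic logarithm `H` with `|Im H| < π`.
PROOF ROUTE (verified on paper by the lead; drefute read-back agrees). Write the Stieltjes data
`f s = a'/s + b + ∫ (s+t)⁻¹ dσ(t)` (`σ (Iic 0) = 0`, `∫(1+t)⁻¹dσ < ∞`). (1) `F z := a'/z + b + ∫ (z+t)⁻¹ dσ(t)` is
holomorphic on `ℂ ∖ (-∞,0]` (dominated differentiation of the parameter integral: for `z` in a small ball around
`z₀ ∉ (-∞,0]`, `|z+t|⁻² ≤ M (1+t)⁻¹` uniformly in `t > 0`) with `Im F z = -Im z · (a'/|z|² + ∫ |z+t|⁻² dσ)`, hence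
`Im z > 0 ⇒ Im F z ≤ 0` (and `< 0` unless `a' = 0 ∧ σ = 0`, in which case `F ≡ b = f 1 > 0`); `F s = f s > 0` for real
`s > 0` (positivity of `C`). So `F` maps `ℂ ∖ (-∞,0]` into `ℂ ∖ (-∞,0]` and `Complex.log ∘ F` is holomorphic there with
`Complex.arg (F z) ∈ (-π, 0]` for `Im z > 0`, `∈ [0, π)` for `Im z < 0`. (2) Use the parameter `c = cos (2ψ)` (entire,
`π`-periodic, even): `ψ` is off the walls iff `c ∉ (-∞,-1] ∪ [1,∞)` (for `ψ = x+iy`,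
`cos 2ψ = cos 2x cosh 2y - i sin 2x sinh 2y` is real iff `y = 0` or `sin 2x = 0`), and then
`w := (1-c)/(1+c) ∈ ℂ ∖ (-∞,0]` (`= tan² ψ`) with `1 + w = 2/(1+c)`, `1 + c ∉ (-∞, 0]`. Put
`H ψ := a • (log 2 - Complex.log (1 + c)) + Complex.log (F w)` and `G := exp ∘ H` off the walls, `G ψ := C(leaf ψ.re)`
on them. Holomorphy is by composition. Band: `Im H = -a·arg(1+c) + arg F(w)` and `arg (1+w) = -arg (1+c)`; for
`Im w > 0`: `arg(1+w) ∈ (0,π)`, `arg F w ∈ (-π,0]` ⇒ `Im H ∈ (-π, aπ) ⊂ (-π,π)` since `0 ≤ a ≤ 1`; symmetric for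
`Im w < 0`; `= 0` for real `w > 0`. (3) Real points: for `ψ ∈ (0, π/2)`, `w = tan²ψ > 0` and
`exp (H ψ) = (1+w)^a f(w) = C (u + tan ψ n̂) = C (cos ψ u + sin ψ n̂)` (0-homogeneity, `cos ψ > 0`); for other real
`ψ` off the walls reduce to `(0, π/2)` with `cos 2(-ψ) = cos 2ψ` (value `C (θ_n k) = C k`) and `cos 2(π - ψ) = cos 2ψ`
(value `C (-θ_n k) = C k`, evenness = homogeneity at `c = -1`). Mathlib: `hasDerivAt_integral_of_dominated_loc_of_deriv_le`,
`Complex.log`, `Complex.arg_le_pi`/`neg_pi_lt_arg`, `Complex.arg_eq_zero_iff`, `Complex.exp_log`,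
`Complex.ofReal_cpow`/`Real.rpow_def_of_pos`, `Complex.cos`, `DifferentiableOn.cexp/clog/comp`. Size: M–L. -/
theorem stub_leafBand :
    ∀ (Δ : ℝ) (C : EuclideanSpace ℝ (Fin 3) → ℝ) (n u : EuclideanSpace ℝ (Fin 3)),
      1 / 2 ≤ Δ → Δ ≤ 3 / 2 → n ≠ 0 → inner ℝ u n = 0 → ‖u‖ = 1 →
      (∀ k, k ≠ 0 → 0 < C k) →
      (∀ c : ℝ, c ≠ 0 → ∀ k, C (c • k) = C k) →
      (∀ k, C (((ℝ ∙ n)ᗮ).reflection k) = C k) →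
      Literature.Analysis.SpecialFunctions.IsStieltjesFunction
        (fun s : ℝ => (1 + s) ^ (-(3 / 2 - Δ)) * C (u + Real.sqrt s • ‖n‖⁻¹ • n)) →
      ∃ G H : ℂ → ℂ,
        DifferentiableOn ℂ G {ψ : ℂ | ∀ m : ℤ, ψ.re ≠ (m : ℝ) * (Real.pi / 2)} ∧
        DifferentiableOn ℂ H {ψ : ℂ | ∀ m : ℤ, ψ.re ≠ (m : ℝ) * (Real.pi / 2)} ∧
        (∀ ψ : ℂ, ψ ∈ {ψ : ℂ | ∀ m : ℤ, ψ.re ≠ (m : ℝ) * (Real.pi / 2)} →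
          Complex.exp (H ψ) = G ψ ∧ |(H ψ).im| < Real.pi) ∧
        (∀ ψ : ℝ, G ψ = ((C (Real.cos ψ • u + Real.sin ψ • ‖n‖⁻¹ • n) : ℝ) : ℂ)) := by
  sorry

/-- **S3 · stub_sevenCircles — the `a`-uniform two-pole circle lemma, definition-free.** If `C` is 0-homogeneous,
invariant under the nine lattice mirrors, and every leaf of every one of the nine fans carries a bounded-phase
continuation (the conclusion of S2 for all nine normals `n` and all units `u ⊥ n`), then `C = C e₀` on the seven
bipolar great circles `{k_i = 0}`, `{k₀+k₁+k₂ = 0}`, `{k₀+k₁ = k₂}`, `{k₀+k₂ = k₁}`, `{k₁+k₂ = k₀}` (off the origin).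
PROOF ROUTE (refuter note 14:15Z (ii); Disproof F2; triage ×3; re-verified by the lead). GLUING LEMMA (generic, prove
first): let `W₁ = (π/2)ℤ`, `W₂ = β + (π/2)ℤ` with `β ∉ (π/2)ℤ`; if `G₁,H₁` are holomorphic on `{Re ∉ W₁}`, `G₂,H₂`
on `{Re ∉ W₂}`, `exp Hᵢ = Gᵢ` and `|Im Hᵢ| < π` there, and `G₁ = g = G₂` on ALL of `ℝ` for one function `g : ℝ → ℂ`,
then `g` is constant: on `V = {Re ∉ W₁ ∪ W₂}` (open vertical strips, each meeting `ℝ` in an interval) `G₁ = G₂` by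
the identity theorem (`DifferentiableOn.analyticOnNhd`, `AnalyticOnNhd.eqOn_of_preconnected_of_frequently_eq`,
strips are convex hence preconnected); `exp H₁ = exp H₂` on `V` gives `H₁ - H₂ ∈ 2πiℤ` POINTWISE with
`|Im (H₁ - H₂)| < 2π`, so `H₁ = H₂` on `V`; `H := if Re ψ ∉ W₁ then H₁ ψ else H₂ ψ` is then entire (locally equal to
`H₁` off `W₁`, to `H₂` near `W₁`), `|Im H| < π`, and `exp (H ψ) = g ψ` for real `ψ` (off `W₁` via `G₁`, on `W₁` via
`G₂`); `boundedPhaseLiouville` (re-prove the 25-line lemma in your file) makes `H`, hence `g`, constant.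
GEOMETRY. Circle `{k₂ = 0}`: leaf of `n = e₀` through `u = e₁` (`k(ψ) = cos ψ e₁ + sin ψ e₀`) and leaf of
`n' = e₀ + e₁` through `u' = (e₁ - e₀)/√2`: `cos ψ u' + sin ψ n̂' = k(ψ - π/4)`, so `G₂(· + π/4)` has walls
`π/4 + (π/2)ℤ`; gluing ⇒ `C ∘ k` constant `= C e₀` (`ψ = π/2`); every `k ≠ 0` with `k₂ = 0` is `‖k‖ • k(ψ)`
(`ψ = arg (k₁ + i k₀)`, cf. `globalConstant_of_nineLeafEntire` in the skeleton) ⇒ `C k = C e₀` by 0-homogeneity.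
Hexagon `{k₀+k₁+k₂ = 0}`: leaf of `n = e₀ - e₁` through `u = (e₀+e₁-2e₂)/√6`; the pole `n̂' = (e₀-e₂)/√2` sits at
`ψ = π/6` (`cos(π/6) u + sin(π/6) n̂ = (e₀-e₂)/√2`), so with `u' := k(π/6 - π/2) = k(-π/3)` the `n'`-leaf is
`k(· - π/3)`… any consistent choice: walls `π/6 + (π/2)ℤ`, disjoint from `(π/2)ℤ`; gluing ⇒ constant, and the value is
`C e₀` because `k(π/2)·√2 = e₀ - e₁` lies on `{k₂ = 0}`. The remaining five circles are images of these two under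
mirrors: `{k₀ = 0} = θ_{e₀-e₂}{k₂ = 0}`, `{k₁ = 0} = θ_{e₁-e₂}{k₂ = 0}`, `{k₀+k₁ = k₂} = θ_{e₂}{Σ = 0}`,
`{k₀+k₂ = k₁} = θ_{e₁}{Σ = 0}`, `{k₁+k₂ = k₀} = θ_{e₀}{Σ = 0}` (`reflection_single_apply`,
`reflection_single_sub_single_apply` from `LatticeMirrorNormals`), so `C k = C (θ k) = C e₀`. Size: M–L. -/
theorem stub_sevenCircles :
    ∀ (C : EuclideanSpace ℝ (Fin 3) → ℝ),
      (∀ c : ℝ, c ≠ 0 → ∀ k, C (c • k) = C k) →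
      (∀ n : EuclideanSpace ℝ (Fin 3), (∃ i j : Fin 3, i ≠ j ∧ (n = EuclideanSpace.single i 1 ∨
          n = EuclideanSpace.single i 1 + EuclideanSpace.single j 1 ∨
          n = EuclideanSpace.single i 1 - EuclideanSpace.single j 1)) →
        ∀ k, C (((ℝ ∙ n)ᗮ).reflection k) = C k) →
      (∀ n : EuclideanSpace ℝ (Fin 3), (∃ i j : Fin 3, i ≠ j ∧ (n = EuclideanSpace.single i 1 ∨
          n = EuclideanSpace.single i 1 + EuclideanSpace.single j 1 ∨
          n = EuclideanSpace.single i 1 - EuclideanSpace.single j 1)) →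
        ∀ u : EuclideanSpace ℝ (Fin 3), inner ℝ u n = 0 → ‖u‖ = 1 →
          ∃ G H : ℂ → ℂ,
            DifferentiableOn ℂ G {ψ : ℂ | ∀ m : ℤ, ψ.re ≠ (m : ℝ) * (Real.pi / 2)} ∧
            DifferentiableOn ℂ H {ψ : ℂ | ∀ m : ℤ, ψ.re ≠ (m : ℝ) * (Real.pi / 2)} ∧
            (∀ ψ : ℂ, ψ ∈ {ψ : ℂ | ∀ m : ℤ, ψ.re ≠ (m : ℝ) * (Real.pi / 2)} →
              Complex.exp (H ψ) = G ψ ∧ |(H ψ).im| < Real.pi) ∧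
            (∀ ψ : ℝ, G ψ = ((C (Real.cos ψ • u + Real.sin ψ • ‖n‖⁻¹ • n) : ℝ) : ℂ))) →
      ∀ k : EuclideanSpace ℝ (Fin 3), k ≠ 0 →
        (k 0 = 0 ∨ k 1 = 0 ∨ k 2 = 0 ∨ k 0 + k 1 + k 2 = 0 ∨ k 0 + k 1 = k 2 ∨ k 0 + k 2 = k 1 ∨
          k 1 + k 2 = k 0) →
        C k = C (EuclideanSpace.single 0 1) := by
  sorry

/-- **S4 · stub_monotoneEndpoint — the endpoint `Δ = 1/2` (`a = 1`) by leaf monotonicity, definition-free**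
(Disproof F9 / `GlobalStep-a1.md`, the sharpening asked for by triage r1-2/r1-3). Hypotheses: `C` continuous and
positive off `0`, 0-homogeneous, nine-mirror invariant, every nine-fan pencil `s ↦ (1+s)⁻¹ C (u + √s n̂)` a
Stieltjes function, and `C = C e₀` on the seven-circle net. Conclusion: `C = C e₀` off `0`.
PROOF ROUTE. One leaf `(n, u)`: `f s = a'/s + b + ∫ (s+t)⁻¹ dσ` equals `(1+s)⁻¹ C (u + √s n̂)` for `s > 0`;
`f s → C u` as `s → 0⁺` (continuity of `C` at `u ≠ 0`) forces `a' = 0` and (monotone convergence) `∫ t⁻¹ dσ = C u - b`;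
`s f s = (s/(1+s)) C (u/√s + n̂) → C n̂` as `s → ∞` (0-homogeneity + continuity at `n̂`) forces `b = 0` and `σ` FINITE
with `σ univ = C n̂` (monotone convergence of `s/(s+t) ↑ 1`). Then for `s > 0`,
`C (u + √s n̂) = (1+s) f s = σ univ + ∫ (1-t)/(s+t) dσ`, and `Φ s := (1+s)(C (u + √s n̂) - C n̂) = ∫ (1+s)(1-t)/(s+t) dσ`
satisfies `Φ s - Φ s' = (s'-s) ∫ (1-t)²/((s+t)(s'+t)) dσ ≥ 0` for `0 < s < s'` (pointwise identity
`leaf_kernel_identity` of `Negative/Descent.lean`, importable), with `Φ 0⁺ = C u - C n̂`; equality `Φ s = Φ s'` for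
some `s < s'` forces `σ ((0,∞) ∖ {1}) = 0`, i.e. `f = σ{1}/(1+s)` and `C` constant on the open quarter-leaf, hence
(by `θ_n`, evenness and continuity) on the whole great circle. GLOBAL (GlobalStep-a1.md Steps 1–3): all eighteen pole
directions `±e_i`, `(±e_i ± e_j)/√2` lie on the net, value `c₀ = C e₀`. Step 1 (`C ≤ c₀`): `C` attains a max `c₀ + m`
on the unit sphere (compact, `ContinuousOn`); at the max point `x*` pick a coordinate pole `e_i` with `x*_i ≠ 0`
(exists) — if `m > 0` then `x* ≠ ±e_i`, `x*` is interior to an `e_i`-leaf at parameter `s* > 0`, and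
`(1+s*) m = Φ(s*) ≤ Φ(0⁺) = C u - c₀ ≤ m` gives `s* m ≤ 0`, contradiction. Step 2 is free here (`{k₂ = 0}` is in the
net). Step 3 (sweep): `P = e₀ + e₂` (a nine-normal, `C P̂ = c₀`); for `v ⊥ P` unit with `v₂ ≠ 0`... every `x` on the
sphere off the plane `{k₀ = k₂}`∪`{P-axis}` lies in the interior of a `P`-leaf which meets `{k₂ = 0}` at an interior
parameter `s_×` where `C = c₀`, so `Φ_P ≤ 0` (Step 1), `Φ_P(s_×) = 0`, `Φ_P` antitone, `Φ_P(0⁺) ≤ 0` ⇒ `Φ_P ≡ 0` on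
`(0, s_×]` ⇒ leaf round ⇒ `C x = c₀`; the plane `{k₀ = k₂}` by continuity (or by the mirror `θ_{e₀-e₂}`… it maps the
plane to itself — use continuity: approximate from off the plane). Mathlib: `IsCompact.exists_isMaxOn` on
`Metric.sphere 0 1`, `MeasureTheory.tendsto_integral_of_monotone`/`lintegral` monotone convergence,
`integral_eq_zero_iff_of_nonneg`, `Measure.restrict`/`ae` manipulations. Size: L. -/
theorem stub_monotoneEndpoint :
    ∀ (C : EuclideanSpace ℝ (Fin 3) → ℝ),
      ContinuousOn C {0}ᶜ →
      (∀ k, k ≠ 0 → 0 < C k) →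
      (∀ c : ℝ, c ≠ 0 → ∀ k, C (c • k) = C k) →
      (∀ n : EuclideanSpace ℝ (Fin 3), (∃ i j : Fin 3, i ≠ j ∧ (n = EuclideanSpace.single i 1 ∨
          n = EuclideanSpace.single i 1 + EuclideanSpace.single j 1 ∨
          n = EuclideanSpace.single i 1 - EuclideanSpace.single j 1)) →
        ∀ k, C (((ℝ ∙ n)ᗮ).reflection k) = C k) →
      (∀ n : EuclideanSpace ℝ (Fin 3), (∃ i j : Fin 3, i ≠ j ∧ (n = EuclideanSpace.single i 1 ∨
          n = EuclideanSpace.single i 1 + EuclideanSpace.single j 1 ∨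
          n = EuclideanSpace.single i 1 - EuclideanSpace.single j 1)) →
        ∀ u : EuclideanSpace ℝ (Fin 3), inner ℝ u n = 0 → ‖u‖ = 1 →
          Literature.Analysis.SpecialFunctions.IsStieltjesFunction
            (fun s : ℝ => (1 + s)⁻¹ * C (u + Real.sqrt s • ‖n‖⁻¹ • n))) →
      (∀ k : EuclideanSpace ℝ (Fin 3), k ≠ 0 →
        (k 0 = 0 ∨ k 1 = 0 ∨ k 2 = 0 ∨ k 0 + k 1 + k 2 = 0 ∨ k 0 + k 1 = k 2 ∨ k 0 + k 2 = k 1 ∨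
          k 1 + k 2 = k 0) →
        C k = C (EuclideanSpace.single 0 1)) →
      ∀ k : EuclideanSpace ℝ (Fin 3), k ≠ 0 → C k = C (EuclideanSpace.single 0 1) := by
  sorry

/-- **S5a · stub_noSpacelikeMass — OPEN CORE 1: no spacelike spectral mass (`1/2 < Δ ≤ 1`).** Every pencil
Stieltjes measure is carried by `[1,∞)` (no atom at `0`, no mass on `(0,1)`, no constant term): the
equatorial walls `Re ψ ∈ πℤ` of every leaf are crossable. In the bounded-phase picture: on each leaf
quarter-strip `v = Im H` is a bounded harmonic function, `v = 0` on the real edge, with one-signed boundary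
values `v ∈ [-π, 0]` on the equatorial wall for EVERY `a` (card (4)); the real data `log C` on `S²` is shared
by all nine fans and is tied to the wall data by the exact Poisson identity
`∂_ψ log C|_{leaf} = ∂_{Im ψ} v|_{Im ψ = 0}` (Cauchy–Riemann), so (L) says the equatorial part of this
positive-kernel transform vanishes identically. Why it might hold: it is crux-implied; partial theorems:
the whole band `|η| < arctanh(0.8165)` of every axis/diagonal fan is already certified free of spacelike mass
by the plain-tube Landau bootstrap (triage r1-2 fixed point √(2/3), cards landau-pinning-residual-annulus /
laplace-lightcone-bootstrap), sector vanishing around the 8 bipolar directions by edge-of-the-wedge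
(card wall-jump-edge-of-the-wedge (4a)); at `a = 1` it is a COROLLARY of S4 (a posteriori). Why it might
fail: a nine-RP kernel with superluminal diagonal spectral mass at slopes `0.82–1` (card 5 falsifier (iii);
cdisprove LP search F8) kills it and the crux together. Bounded-phase tools offered: normal-family closedness
of "continues with `|Im H| < π`" in the conic-pencil parameter, signed scalar wall datum, maximum principle on
strips. Stated for `1/2 < Δ ≤ 1` only (the endpoint is S4; by `hrp2RigidityAt_of_add` `Δ = 1` is hardest).
Size: XL (open). -/
theorem stub_noSpacelikeMass :
    ∀ (Δ : ℝ) (K C : E3 → ℝ), 1/2 < Δ → CruxHyp Δ K → IsFourierProfile Δ K C → NineLeafBand C →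
      NetConstant C → NoSpacelikeMass Δ C := by
  sorry

/-- **S5b · stub_polarPhase — OPEN CORE 2: with (L), the polar walls are removable (`1/2 < Δ ≤ 1`).**
Given no spacelike mass in all nine fans, every leaf function of every fan is the restriction of an ENTIRE
function with an entire logarithm of `|Im| ≤ π` (`NineLeafEntire`; then `globalConstant_of_nineLeafEntire`,
kernel-checked below, finishes). After (L) each pencil is `∫_{[1,∞)} dσ/(s+t)`, holomorphic on
`ℂ ∖ (-∞,-1]`, so the leaf function `G = ((1+s)^a f) ∘ tan²` is already holomorphic off the POLAR LINES
`Re ψ ∈ π/2 + πℤ` (equatorial walls gone, including their real points), with `|Im H| < π` and polar boundary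
phases in `[-(1-a)π, aπ]`; what remains is the timelike phase. Two engines: (i) x-side, card
causal-commutator-spin-bound: (L) = forward-light-cone support of the nine OS measures makes `K` the boundary
value of a function holomorphic in nine forward tubes, real at the spacelike points of each frame (no jump
across the de Sitter wall = (L) again, k-side), and the Jost–Lehmann–Dyson / Dyson-1958 mode classification
bounds the transverse spin of a homogeneous causal cone-supported measure by `m ≤ 2Δ - 1 < 2`, so `D₄`
symmetry forces `m = 0`: axial symmetry about every normal ⇒ `C` constant ⇒ `NineLeafEntire` with constant
`G`, `H`; (ii) ψ-side (this line): triviality of the `O_h`-coupled family of leaf data holomorphic off the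
polar slits with phase in the band = the nonlinear form of Disproof F12's tangent space `V_R = ℝ`; real
analyticity of `C` at the poles (`IsFourierProfile.analytic`) makes the polar slits start at positive height.
Why it might fail: F12 — a non-constant `H ∈ V_R` would refute the crux on all of `(1/2, 1]`; F11 — for
`a < 1` single leaves DO have interior bumps (`(2+w)^{-1/2} + λ(1.1+w)^{1/2}`), so no leafwise maximum
principle: the coupling across fans through `C|S²` (Disproof F3) is essential. At `a = 1` the statement is
Disproof F6 (proved on paper). Size: L–XL. -/
theorem stub_polarPhase :
    ∀ (Δ : ℝ) (K C : E3 → ℝ), 1/2 < Δ → CruxHyp Δ K → IsFourierProfile Δ K C → NineLeafBand C →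
      NetConstant C → NoSpacelikeMass Δ C → NineLeafEntire C := by
  sorry

/-- **S7 · stub_fourierUniqueness — a constant profile makes `K` isotropic, definition-free.** If `K` is continuous
off `0`, `∫ K · 𝓕φ = ∫ ‖k‖^(-(3-2Δ)) C(k) φ(k)` for every Schwartz `φ` (Mathlib's `𝓕`), and `C = C e₀` off `0`, then
`K ∘ R = K` for every linear isometry `R`.
PROOF ROUTE (no Riesz-potential integrability needed). For Schwartz `φ` and `R`: `φ ∘ R` is Schwartz
(`SchwartzMap.compCLMOfContinuousLinearEquiv` with `R.toContinuousLinearEquiv`) and `𝓕 (φ ∘ R) = (𝓕 φ) ∘ R`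
(`Real.fourier_comp_linearIsometry`); the right-hand side is the same for `φ` and `φ ∘ R` (change of variables
`MeasurePreserving.integral_comp R.measurePreserving R.toHomeomorph.measurableEmbedding`, `‖R k‖ = ‖k‖`, and `C` is a.e.
the constant `C e₀` — `{0}` is null); the left-hand side for `φ ∘ R` is `∫ K (R.symm x) (𝓕 φ) x` by the same change of
variables. Hence `∫ (K ∘ R.symm) ψ = ∫ K ψ` for every `ψ` in the range of `𝓕` on `𝓢`, which is all of `𝓢`
(`SchwartzMap.fourierTransformCLE`, `FourierTransform.fourierCLE_apply`/`fourier_coe`). Take `ψ` = a smooth function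
compactly supported in `U = {0}ᶜ` (build the `SchwartzMap` from `ContDiff` + `HasCompactSupport`: all
`‖x‖^k ‖iteratedFDeriv ℝ n ψ x‖` are bounded, `HasCompactSupport.iteratedFDeriv`, `IsCompact.exists_bound_of_continuousOn`);
both `K ψ` and `(K ∘ R.symm) ψ` are then integrable (continuous on the compact support), so
`∫ ψ • (K ∘ R.symm - K) = 0`, and `IsOpen.ae_eq_zero_of_integral_contDiff_smul_eq_zero` (Mathlib
`Analysis/Distribution/AEEqOfIntegralContDiff.lean`; `K`, `K ∘ R.symm` are `LocallyIntegrableOn U` being continuous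
there) gives `K ∘ R.symm = K` a.e. on `U`, hence everywhere on `U` (both continuous on the open set `U`:
a.e.-equal continuous functions agree on open sets of positive measure around each point), and trivially at `0`.
Apply with `R.symm` in place of `R`. Size: M. -/
theorem stub_fourierUniqueness :
    ∀ (Δ : ℝ) (K C : EuclideanSpace ℝ (Fin 3) → ℝ),
      ContinuousOn K {0}ᶜ →
      (∀ φ : SchwartzMap (EuclideanSpace ℝ (Fin 3)) ℂ,
        ∫ x, (K x : ℂ) * FourierTransform.fourier (φ : EuclideanSpace ℝ (Fin 3) → ℂ) x =
          ∫ k, ((‖k‖ ^ (-(3 - 2 * Δ)) * C k : ℝ) : ℂ) * φ k) →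
      (∀ k : EuclideanSpace ℝ (Fin 3), k ≠ 0 → C k = C (EuclideanSpace.single 0 1)) →
      ∀ (R : EuclideanSpace ℝ (Fin 3) ≃ₗᵢ[ℝ] EuclideanSpace ℝ (Fin 3)) (x : EuclideanSpace ℝ (Fin 3)),
        K (R x) = K x := by
  sorry

/-! ## The composition (kernel-checked, no sorry of its own): the stubs prove the crux BY NAME -/

/-- S2 for all nine fans, in the skeleton's vocabulary. -/
theorem nineLeafBand_of_profile {Δ : ℝ} {K C : E3 → ℝ} (hyp : CruxHyp Δ K) (hC : IsFourierProfile Δ K C) :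
    NineLeafBand C := by
  intro n hn u hu hu1
  exact stub_leafBand Δ C n u hyp.half_le (by linarith [hyp.le_one]) (nineNormal_ne_zero hn) hu hu1 hC.pos
    hC.homogeneous (hC.nine_inv n hn) (hC.stieltjes n hn u hu hu1)

/-- S3 in the skeleton's vocabulary. -/
theorem netConstant_of_profile {Δ : ℝ} {K C : E3 → ℝ} (hC : IsFourierProfile Δ K C) (hband : NineLeafBand C) :
    NetConstant C :=
  fun k hk hseven => stub_sevenCircles C hC.homogeneous hC.nine_inv hband k hk hseven

/-- S4 in the skeleton's vocabulary. -/
theorem globalConstant_half_of_profile {K C : E3 → ℝ} (hC : IsFourierProfile (1 / 2) K C) (hnet : NetConstant C) :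
    GlobalConstant C := by
  refine stub_monotoneEndpoint C hC.analytic.continuousOn hC.pos hC.homogeneous hC.nine_inv ?_ hnet
  intro n hn u hu hu1
  exact (hC.stieltjes n hn u hu hu1).congr fun s _ => pencil_half_apply C n u s

/-- **`HRP2Rigidity_of`** — `stub_dictionary → stub_leafBand → stub_sevenCircles →
(stub_monotoneEndpoint | stub_noSpacelikeMass → stub_polarPhase → Liouville endgame) → stub_fourierUniqueness`
proves `HyperoctahedralRP.HRP2Rigidity` verbatim: take the profile `C` (S1), its leaf bands (S2), constancy
on the 7-circle net (S3); at `Δ = 1/2` conclude global constancy by monotonicity (S4), for `1/2 < Δ ≤ 1`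
remove the equatorial walls (S5a, (L)) and the polar walls (S5b) and run the kernel-checked bounded-phase
Liouville endgame (`globalConstant_of_nineLeafEntire`); a constant profile makes `K` isotropic (S7). -/
theorem HRP2Rigidity_of :
    Summit.CriticalPhenomena.Ising3DConformalLimit.Theses.HyperoctahedralRP.HRP2Rigidity := by
  intro Δ K h1 h2 hc hpos hhom hnine R x
  have hyp : CruxHyp Δ K := ⟨h1, h2, hc, hpos, hhom, hnine⟩
  obtain ⟨C, hC⟩ := stub_dictionary Δ K hyp
  have hband : NineLeafBand C := nineLeafBand_of_profile hyp hC
  have hnet : NetConstant C := netConstant_of_profile hC hband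
  have hglob : GlobalConstant C := by
    rcases h1.eq_or_lt with h | h
    · subst h
      exact globalConstant_half_of_profile hC hnet
    · exact globalConstant_of_nineLeafEntire C hC.homogeneous
        (stub_polarPhase Δ K C h hyp hC hband hnet (stub_noSpacelikeMass Δ K C h hyp hC hband hnet))
  exact stub_fourierUniqueness Δ K C hc hC.fourier hglob R x

/-- **Milestone inside the line (no open core needed): the endpoint `Δ = 1/2`.** Stubs S1, S2, S3, S4, S7
alone give the crux at the exponent `Δ = 1/2` (`a = 1`): two-point `O(3)` symmetry of every nine-mirror-RP
kernel of degree `-1`. (By `hrp2Rigidity_descent` this is also implied by the crux at `Δ = 1`, the hardest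
exponent, which needs S5a/S5b.) -/
theorem hrp2Rigidity_at_half (K : E3 → ℝ) (h : CruxHyp (1 / 2) K) :
    ∀ (R : E3 ≃ₗᵢ[ℝ] E3) (x : E3), K (R x) = K x := by
  obtain ⟨C, hC⟩ := stub_dictionary (1 / 2) K h
  exact stub_fourierUniqueness (1 / 2) K C h.continuousOn hC.fourier
    (globalConstant_half_of_profile hC (netConstant_of_profile hC (nineLeafBand_of_profile h hC)))

end Summit.CriticalPhenomena.Ising3DConformalLimit.Cruxes.HRP2Rigidity.BoundedPhaseQuadricLiouville

end
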